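import Literature.AlgebraicGeometry.Morphisms.CechModuleRefinement
import Literature.AlgebraicGeometry.Modules.AffineLocalizing
import Mathlib.Tactic.Module
import HarnessLib

/-!
# Vanishing of `Ȟ¹` of a quasi-coherent module on a principal covering of an affine open

The module version of the first half of `Morphisms/CechH1AffineProofs`: for a scheme `f : X → Spec A`,
an affine-localizing (e.g. QUASI-COHERENT) sheaf of `𝒪_X`-modules `M`
(`Literature.AlgebraicGeometry.Modules.IsAffineLocalizing`), an affine open `V ⊆ X` and finitely many functions
`r_l ∈ Γ(V, 𝒪_X)` generating the unit ideal, every Čech `1`-cocycle of `M` on the principal covering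
`(D(r_l))_l` of `V` is a coboundary (Görtz–Wedhorn I, Lemma 12.33 for `p = 1` and the
`Γ(V, 𝒪_X)`-module `Γ(V, M)`: the Čech complex of `M~` on a standard covering of `Spec R` is exact;
Hartshorne III Thm. 3.5 / II Prop. 5.6 in Čech form; The Stacks Project, Tag 01X8). The proof is the
printed partition-of-unity computation, run on sections: with `Γ(D(r), M) = Γ(V, M)_r`
(`Literature/AlgebraicGeometry/Modules/QcohLocalization`, Hartshorne II Lemma 5.3) write
`c_{lm} = x_{lm} / (r_l r_m)^K`, `x_{lm} ∈ Γ(V, M)`; the cocycle identity on `D(r_j r_l r_m)` gives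
`r_j^N (r_j^K x_{lm} - r_l^K x_{jm} + r_m^K x_{jl}) = 0` in `Γ(D(r_l r_m), M)`; with
`Σ_j h_j r_j^{K+N} = 1`, `b_l = r_l^{-K} Σ_j h_j r_j^N x_{jl}` has `d⁰ b = c` (the module identity is
`cech_partition_identity_smul`).

* `MSections.exists_res_eq_pow_smul`, `MSections.exists_pow_smul_eq_zero` — numerators and torsion
  for `MSections` (the two fields of `IsAffineLocalizing`, `Modules/AffineLocalizing`);
* `cech_partition_identity_smul` — the identity of Görtz–Wedhorn I, Lemma 12.33, in a module;
* `cechMZ1_le_cechMB1_basicOpen` — **the theorem**.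

The case of an arbitrary family of opens covering `V` (refine by principal opens, Cor. 21.81) is in
`Morphisms/CechModuleAffine`. Everything is proved; no named facts. Mathlib searched (pin v4.32):
`IsAffineOpen.basicOpen`, `Scheme.basicOpen_mul`, `Scheme.basicOpen_res`,
`IsAffineOpen.iSup_basicOpen_eq_self_iff`, `Ideal.span_pow_eq_top`, `RingedSpace.isUnit_res_basicOpen`,
the `module` / `linear_combination` tactics (used).

## References

* U. Görtz, T. Wedhorn, *Algebraic Geometry I: Schemes*, 2nd ed. (2020): Prop. 12.32 and Lemma 12.33
  with (12.8.1), p. 421 (read via the held copy). [GortzWedhorn2020]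
* R. Hartshorne, *Algebraic Geometry*, GTM 52 (1977): II Lemma 5.3 (p. 112), II Prop. 5.6, III Thm. 3.5.
  [Hartshorne1977]
* The Stacks Project, Tag 01X8 (Čech cohomology of quasi-coherent sheaves), Tag 01X9. [StacksProject]
-/

noncomputable section

open CategoryTheory AlgebraicGeometry Limits TopologicalSpace Opposite

universe u v

namespace Literature.AlgebraicGeometry.Morphisms

/-! ## The module identity behind Lemma 12.33 (`p = 1`) -/

/-- The partition-of-unity identity of Görtz–Wedhorn I, Lemma 12.33 (`p = 1`), in a module `N` over a
commutative ring `R`: if `α p_l = 1 = β p_m`, `Σ_j a_j t_j^{K+N} = 1`,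
`t_j^N • (t_j^K • Z - p_l^K • Y_j + p_m^K • X_j) = 0` for all `j` and `Z = (p_l p_m)^K • c`, then
`c = β^K • Σ_j (a_j t_j^N) • Y_j - α^K • Σ_j (a_j t_j^N) • X_j`.
[cite: GortzWedhorn2020, Lemma 12.33 proof (p. 421)] -/
theorem cech_partition_identity_smul {R : Type*} [CommRing R] {N : Type*} [AddCommGroup N]
    [Module R N] {L : Type*} [Fintype L] (K N₀ : ℕ) (α β pl pm : R) (Z c : N) (t a : L → R)
    (Xj Yj : L → N) (hα : α * pl = 1) (hβ : β * pm = 1) (hsum : ∑ j, a j * t j ^ (K + N₀) = 1)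
    (htors : ∀ j, t j ^ N₀ • (t j ^ K • Z - pl ^ K • Yj j + pm ^ K • Xj j) = 0)
    (hZ : Z = (pl * pm) ^ K • c) :
    c = β ^ K • ∑ j, (a j * t j ^ N₀) • Yj j - α ^ K • ∑ j, (a j * t j ^ N₀) • Xj j := by
  have e1 : (α * pl) ^ K = 1 := by rw [hα, one_pow]
  have e2 : (β * pm) ^ K = 1 := by rw [hβ, one_pow]
  have hj : ∀ j, (a j * t j ^ (K + N₀)) • Z =
      (a j * t j ^ N₀ * pl ^ K) • Yj j - (a j * t j ^ N₀ * pm ^ K) • Xj j := by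
    intro j
    have h := congrArg (fun v => a j • v) (htors j)
    simp only [smul_zero] at h
    rw [← sub_eq_zero, ← h, pow_add]
    module
  have hZ' : Z = ∑ j, ((a j * t j ^ N₀ * pl ^ K) • Yj j - (a j * t j ^ N₀ * pm ^ K) • Xj j) := by
    calc Z = (∑ j, a j * t j ^ (K + N₀)) • Z := by rw [hsum, one_smul]
      _ = ∑ j, (a j * t j ^ (K + N₀)) • Z := Finset.sum_smul
      _ = _ := Finset.sum_congr rfl fun j _ => hj j
  have hc : c = (α * β) ^ K • Z := by
    rw [hZ, smul_smul, ← mul_pow, show α * β * (pl * pm) = (α * pl) * (β * pm) by ring, mul_pow, e1,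
      e2, one_mul, one_smul]
  rw [hc, hZ', Finset.smul_sum, Finset.smul_sum, Finset.smul_sum, ← Finset.sum_sub_distrib]
  refine Finset.sum_congr rfl fun j _ => ?_
  rw [smul_sub, smul_smul, smul_smul, smul_smul, smul_smul]
  congr 2
  · linear_combination (β ^ K * (a j * t j ^ N₀)) * e1
  · linear_combination (α ^ K * (a j * t j ^ N₀)) * e2

variable {A : Type u} [CommRing A] {X : Scheme.{u}} (f : X ⟶ Spec (.of A)) (M : X.Modules)

/-! ## Principal opens of an affine open: numerators and torsion for `MSections` -/

namespace MSections

variable {M} (hM : Literature.AlgebraicGeometry.Modules.IsAffineLocalizing M) {V : X.Opens}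
  (hV : IsAffineOpen V)

include hM hV

/-- **Numerators** (`Γ(D(g), M) = Γ(V, M)_g`, Hartshorne II Lemma 5.3 (b)): a section `s` of the
affine-localizing `M` over `W = D(g)`, `g ∈ Γ(V, 𝒪_X)`, `V` affine, satisfies `x|_W = g^n|_W • s` for
some `x ∈ Γ(V, M)`. [cite: Hartshorne1977, II Lemma 5.3 (b) p. 112 (PDF p. 141)] -/
theorem exists_res_eq_pow_smul (g : Sections f V) {W : X.Opens} (hW : W = X.basicOpen g)
    (s : MSections f M W) :
    ∃ (n : ℕ) (x : MSections f M V), MSections.res f M (hW.le.trans (X.basicOpen_le g)) x =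
      Sections.res f (hW.le.trans (X.basicOpen_le g)) g ^ n • s :=
  hM.numerator hV g hW s

/-- **Torsion** (`Γ(D(g), M) = Γ(V, M)_g`, Hartshorne II Lemma 5.3 (a)): a section `x ∈ Γ(V, M)`
vanishing on an open `W` with `D(g) ⊆ W ⊆ V` is killed by a power of `g`.
[cite: Hartshorne1977, II Lemma 5.3 (a) p. 112 (PDF p. 141)] -/
theorem exists_pow_smul_eq_zero (g : Sections f V) (x : MSections f M V) {W : X.Opens}
    (hWV : W ≤ V) (hgW : X.basicOpen g ≤ W) (hx : MSections.res f M hWV x = 0) :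
    ∃ n : ℕ, g ^ n • x = 0 :=
  hM.torsion hV g x hWV hgW hx

end MSections

/-! ## Lemma 12.33 for `p = 1`: principal coverings of an affine open -/

section StandardCover

variable {M} (hM : Literature.AlgebraicGeometry.Modules.IsAffineLocalizing M) {V : X.Opens}
  (hV : IsAffineOpen V) {L : Type v} (r : L → Sections f V)

include hM hV in
/-- **Görtz–Wedhorn I, Lemma 12.33 (`p = 1`) for the `Γ(V, 𝒪)`-module `Γ(V, M)`**: for an affine open
`V`, an affine-localizing (e.g. quasi-coherent) `M` and finitely many `r_l ∈ Γ(V, 𝒪)` generating the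
unit ideal, every Čech `1`-cocycle of `M` on the principal covering `(D(r_l))_l` of `V` is a coboundary.
[cite: GortzWedhorn2020, Lemma 12.33 (p. 421)] -/
theorem cechMZ1_le_cechMB1_basicOpen [Fintype L] (hr : Ideal.span (Set.range r) = ⊤) :
    cechMZ1 f M (fun l => X.basicOpen (r l)) ≤ cechMB1 f M (fun l => X.basicOpen (r l)) := by
  classical
  intro c hc
  have h2V : ∀ l m, X.basicOpen (r l) ⊓ X.basicOpen (r m) ≤ V :=
    fun l m => inf_le_left.trans (X.basicOpen_le (r l))
  -- (1) numerators with a uniform exponent `K`: `x_{lm}|_{D_lm} = (r_l r_m)^K • c_{lm}`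
  have hnum : ∀ l m, ∃ (n : ℕ) (x : MSections f M V), MSections.res f M (h2V l m) x =
      Sections.res f (h2V l m) (r l * r m) ^ n • c l m :=
    fun l m => MSections.exists_res_eq_pow_smul f hM hV (r l * r m) (X.basicOpen_mul (r l) (r m)).symm
      (c l m)
  choose n x hx using hnum
  obtain ⟨K, hK⟩ : ∃ K, ∀ l m, n l m ≤ K :=
    ⟨Finset.univ.sup fun p : L × L => n p.1 p.2,
      fun l m => Finset.le_sup (f := fun p : L × L => n p.1 p.2) (Finset.mem_univ (l, m))⟩
  set x' : L → L → MSections f M V := fun l m => (r l * r m) ^ (K - n l m) • x l m with hx'def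
  have hx' : ∀ l m, MSections.res f M (h2V l m) (x' l m) =
      Sections.res f (h2V l m) (r l * r m) ^ K • c l m := by
    intro l m
    simp only [hx'def, MSections.res_smul, map_pow, hx l m, smul_smul, pow_sub_mul_pow _ (hK l m)]
  -- (2) torsion from the cocycle identity, uniform exponent `N`:
  --     `r_j^N • (r_j^K • x_{lm} - r_l^K • x_{jm} + r_m^K • x_{jl}) = 0` on `D_lm`
  have htors : ∀ j l m, ∃ N : ℕ, Sections.res f (h2V l m) (r j) ^ N •
      MSections.res f M (h2V l m) (r j ^ K • x' l m - r l ^ K • x' j m + r m ^ K • x' j l) = 0 := by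
    intro j l m
    have haff : IsAffineOpen (X.basicOpen (r l) ⊓ X.basicOpen (r m)) := by
      rw [← X.basicOpen_mul]; exact hV.basicOpen _
    have hT : X.basicOpen (r j) ⊓ X.basicOpen (r l) ⊓ X.basicOpen (r m) ≤
        X.basicOpen (r l) ⊓ X.basicOpen (r m) := le_inf (inf_le_left.trans inf_le_right) inf_le_right
    have hgT : X.basicOpen (Sections.res f (h2V l m) (r j)) ≤
        X.basicOpen (r j) ⊓ X.basicOpen (r l) ⊓ X.basicOpen (r m) := by
      rw [Sections.res_apply, Scheme.basicOpen_res]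
      exact le_inf (le_inf inf_le_right (inf_le_left.trans inf_le_left))
        (inf_le_left.trans inf_le_right)
    refine MSections.exists_pow_smul_eq_zero f hM haff (Sections.res f (h2V l m) (r j)) _ hT hgT ?_
    have hcoc := cechMZ1.cocycle_res f M (fun l => X.basicOpen (r l)) hc j l m
      (inf_le_left.trans inf_le_left : X.basicOpen (r j) ⊓ X.basicOpen (r l) ⊓ X.basicOpen (r m) ≤ _)
      (inf_le_left.trans inf_le_right) inf_le_right
    have exl := congrArg (MSections.res f M hT) (hx' l m)
    have exjm := congrArg (MSections.res f M (le_inf (inf_le_left.trans inf_le_left) inf_le_right :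
      X.basicOpen (r j) ⊓ X.basicOpen (r l) ⊓ X.basicOpen (r m) ≤ X.basicOpen (r j) ⊓ X.basicOpen (r m)))
      (hx' j m)
    have exjl := congrArg (MSections.res f M (inf_le_left :
      X.basicOpen (r j) ⊓ X.basicOpen (r l) ⊓ X.basicOpen (r m) ≤ X.basicOpen (r j) ⊓ X.basicOpen (r l)))
      (hx' j l)
    simp only [MSections.res_smul, map_pow, map_mul, MSections.res_res, Sections.res_res] at exl exjm exjl
    simp only [map_add, map_sub, MSections.res_smul, map_pow, MSections.res_res, Sections.res_res]
    rw [exl, exjm, exjl]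
    -- the cocycle identity times `(r_j r_l r_m)^K`
    set T := X.basicOpen (r j) ⊓ X.basicOpen (r l) ⊓ X.basicOpen (r m)
    set ρj := Sections.res f (hT.trans (h2V l m)) (r j)
    set ρl := Sections.res f (hT.trans (h2V l m)) (r l)
    set ρm := Sections.res f (hT.trans (h2V l m)) (r m)
    have key := congrArg (fun v => (ρj * ρl * ρm) ^ K • v) hcoc
    simp only [smul_zero] at key
    rw [← key]
    module
  choose N hN using htors
  obtain ⟨N₀, hN₀⟩ : ∃ N₀, ∀ j l m, N j l m ≤ N₀ :=
    ⟨Finset.univ.sup fun p : L × L × L => N p.1 p.2.1 p.2.2, fun j l m =>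
      Finset.le_sup (f := fun p : L × L × L => N p.1 p.2.1 p.2.2) (Finset.mem_univ (j, l, m))⟩
  have hN' : ∀ j l m, Sections.res f (h2V l m) (r j) ^ N₀ •
      (Sections.res f (h2V l m) (r j) ^ K • MSections.res f M (h2V l m) (x' l m) -
        Sections.res f (h2V l m) (r l) ^ K • MSections.res f M (h2V l m) (x' j m) +
        Sections.res f (h2V l m) (r m) ^ K • MSections.res f M (h2V l m) (x' j l)) = 0 := by
    intro j l m
    have h := hN j l m
    simp only [map_add, map_sub, MSections.res_smul, map_pow] at h
    have e : N₀ = (N₀ - N j l m) + N j l m := (Nat.sub_add_cancel (hN₀ j l m)).symm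
    rw [e, pow_add, mul_smul, h, smul_zero]
  -- (3) partition of unity `Σ_j a_j r_j^{K+N₀} = 1`
  obtain ⟨a, ha⟩ : ∃ a : L → Sections f V, ∑ j, a j * r j ^ (K + N₀) = 1 := by
    have h1 := Ideal.span_pow_eq_top (Set.range r) hr (K + N₀)
    rw [← Set.range_comp, Ideal.eq_top_iff_one] at h1
    exact Ideal.mem_span_range_iff_exists_fun.mp h1
  -- (4) the cochain `b_l = r_l^{-K} Σ_j a_j r_j^{N₀} x_{jl}` on `D_l`
  have hunit : ∀ l, IsUnit (Sections.res f (X.basicOpen_le (r l)) (r l)) :=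
    fun l => X.toRingedSpace.isUnit_res_basicOpen (r l)
  set b : CechMC0 f M (fun l => X.basicOpen (r l)) := fun l =>
    (((hunit l).unit⁻¹ : (Sections f (X.basicOpen (r l)))ˣ) : Sections f (X.basicOpen (r l))) ^ K •
      ∑ j, MSections.res f M (X.basicOpen_le (r l)) ((a j * r j ^ N₀) • x' j l) with hb
  refine (mem_cechMB1_iff f M _ c).mpr ⟨b, ?_⟩
  funext l m
  rw [cechMD0_apply]
  simp only [hb, MSections.res_smul, map_pow, map_sum, MSections.res_res]
  -- (5) the module identity on `D_l ∩ D_m`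
  have key := cech_partition_identity_smul (R := Sections f (X.basicOpen (r l) ⊓ X.basicOpen (r m)))
    K N₀
    (Sections.res f inf_le_left (((hunit l).unit⁻¹ : (Sections f (X.basicOpen (r l)))ˣ) : _))
    (Sections.res f inf_le_right (((hunit m).unit⁻¹ : (Sections f (X.basicOpen (r m)))ˣ) : _))
    (Sections.res f (h2V l m) (r l)) (Sections.res f (h2V l m) (r m))
    (MSections.res f M (h2V l m) (x' l m)) (c l m)
    (fun j => Sections.res f (h2V l m) (r j)) (fun j => Sections.res f (h2V l m) (a j))
    (fun j => MSections.res f M (h2V l m) (x' j l)) (fun j => MSections.res f M (h2V l m) (x' j m))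
    (by
      rw [← Sections.res_res f (X.basicOpen_le (r l)) (inf_le_left : X.basicOpen (r l) ⊓ _ ≤ _),
        ← map_mul, (hunit l).val_inv_mul, map_one])
    (by
      rw [← Sections.res_res f (X.basicOpen_le (r m)) (inf_le_right : _ ⊓ X.basicOpen (r m) ≤ _),
        ← map_mul, (hunit m).val_inv_mul, map_one])
    (by
      have := congrArg (Sections.res f (h2V l m)) ha
      simpa only [map_sum, map_mul, map_pow, map_one] using this)
    (hN' · l m)
    (by rw [hx' l m, map_mul])
  rw [key]
  simp only [map_mul, map_pow, Sections.res_res]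

end StandardCover

end Literature.AlgebraicGeometry.Morphisms

end
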